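import Mathlib
import Summits.Ventures.PercRepro2.Defs
import Summits.Ventures.PercRepro2.Graph
import Summits.Ventures.PercRepro2.Harris
import Summits.Ventures.PercRepro2.PsiTEdge
import Summits.Ventures.PercRepro2.RowC1PendZ
import Summits.Ventures.PercRepro2.RowC1PendZTwoEdge
import Summits.Ventures.PercRepro2.RowC1PendZTwoEdgeThm

/-!
# (Z″) on the tight family «o adjacent only to a₂ and v» (blind cell PercRepro2, p2 g35;
proofs/P2-G35-PENDZ.md §9)

The twin of `RowC1PendZTwoEdgeThm` with the degree-two vertex at the other mark: if `o`'s only edges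
are `e₁ = a₂o` (weight `α`) and `e₂ = vo` (weight `ε`), then with `P₀ = p[e₁↦0][e₂↦0]`
`zpp = α ε (1 − α)(1 − ε)(1 − αε) · P₀(v ↮ a₂) · [P₀(b ↔ {v, a₂}) · P₀(v ↮ a₂) − P₀(b ↔ a₂, v ↮ a₂)]`
(`zpp_two_edge_o_eq`), and the bracket is `≥ 0` by Harris for the increasing `{b ↔ a₂} ∪ {b ↔ v}`
against the decreasing `{v ↮ a₂}` (`zpp_two_edge_o_nonneg`).  Same architecture as the `b`-family
file; the pin-state lemmas are reused with the degree-two vertex `o`.  Std axioms.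
-/

namespace Summit.Ventures.PercRepro2

namespace RowC1

section TwoEdgeO

variable {V : Type*} {E : Type*} [Fintype E] [DecidableEq E]
  {R : Type*} [Field R] [LinearOrder R] [IsStrictOrderedRing R]

variable (p : E → R) (hp : IsProbVec p) (ends : E → Sym2 V) (e₁ e₂ : E) (a₂ v o b : V)

include hp in
/-- **Closed form of `(Z″)` on the `o`-family**: `o`'s only edges are `e₁ = a₂o`, `e₂ = vo`. -/
theorem zpp_two_edge_o_eq (h1 : ends e₁ = s(a₂, o)) (h2 : ends e₂ = s(v, o))
    (hdeg : ∀ e, o ∈ ends e → e = e₁ ∨ e = e₂) (he : e₁ ≠ e₂) (hob : o ≠ b) (hoa : o ≠ a₂)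
    (hov : o ≠ v) :
    zpp p ends v a₂ o b =
      p e₁ * p e₂ * (1 - p e₁) * (1 - p e₂) * (1 - p e₁ * p e₂) *
        (1 - prob (Function.update (Function.update p e₁ (0 : R)) e₂ (0 : R))
          (connEvent ends a₂ v)) *
        (prob (Function.update (Function.update p e₁ (0 : R)) e₂ (0 : R))
            (connEvent ends a₂ b ∪ connEvent ends v b) *
          (1 - prob (Function.update (Function.update p e₁ (0 : R)) e₂ (0 : R))
            (connEvent ends a₂ v)) -
          (prob (Function.update (Function.update p e₁ (0 : R)) e₂ (0 : R)) (connEvent ends a₂ b) -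
            prob (Function.update (Function.update p e₁ (0 : R)) e₂ (0 : R))
              (connEvent ends a₂ b ∩ connEvent ends a₂ v))) := by
  set P00 := Function.update (Function.update p e₁ (0 : R)) e₂ (0 : R) with hP00
  set P10 := Function.update (Function.update p e₁ (1 : R)) e₂ (0 : R) with hP10
  set P01 := Function.update (Function.update p e₁ (0 : R)) e₂ (1 : R) with hP01
  set P11 := Function.update (Function.update p e₁ (1 : R)) e₂ (1 : R) with hP11
  have hp00 : IsProbVec P00 := (hp.update e₁ le_rfl zero_le_one).update e₂ le_rfl zero_le_one
  have hp01 : IsProbVec P01 := (hp.update e₁ le_rfl zero_le_one).update e₂ zero_le_one le_rfl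
  have hp11 : IsProbVec P11 := (hp.update e₁ zero_le_one le_rfl).update e₂ zero_le_one le_rfl
  set F := connEvent ends a₂ v with hF
  set O := connEvent ends a₂ o with hO
  set B := connEvent ends a₂ b with hB
  set W := connEvent ends v o with hW
  set Vb := connEvent ends v b with hVb
  -- configuration-level equivalences (the degree-two vertex is `o`)
  have iF10 : ∀ ω : Config E, ω e₂ = false →
      (Function.update ω e₁ true ∈ F ↔ Function.update ω e₁ false ∈ F) :=
    fun ω hc => conn_update_e₁_iff ends e₁ e₂ a₂ v o a₂ v h1 h2 hdeg he hoa.symm hov.symm ω hc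
  have iB10 : ∀ ω : Config E, ω e₂ = false →
      (Function.update ω e₁ true ∈ B ↔ Function.update ω e₁ false ∈ B) :=
    fun ω hc => conn_update_e₁_iff ends e₁ e₂ a₂ v o a₂ b h1 h2 hdeg he hoa.symm hob.symm ω hc
  have iW10 : ∀ ω : Config E, ω e₂ = false →
      (Function.update ω e₁ true ∈ W ↔ Function.update ω e₁ false ∈ F) := by
    intro ω hc
    have hoa' : Conn ends (Function.update ω e₁ true) o a₂ :=
      conn_of_openAdj ⟨e₁, by simp, by rw [h1, Sym2.eq_swap]⟩
    have hFω := conn_update_e₁_iff ends e₁ e₂ a₂ v o v a₂ h1 h2 hdeg he hov.symm hoa.symm ω hc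
    constructor
    · intro h; exact conn_symm (hFω.1 (conn_trans h hoa'))
    · intro h; exact conn_trans (hFω.2 (conn_symm h)) (conn_symm hoa')
  have iF01 : ∀ ω : Config E, ω e₁ = false →
      (Function.update ω e₂ true ∈ F ↔ Function.update ω e₂ false ∈ F) :=
    fun ω hc => conn_update_e₂_iff ends e₁ e₂ a₂ v o a₂ v h1 h2 hdeg he hoa.symm hov.symm ω hc
  have iB01 : ∀ ω : Config E, ω e₁ = false →
      (Function.update ω e₂ true ∈ B ↔ Function.update ω e₂ false ∈ B) :=
    fun ω hc => conn_update_e₂_iff ends e₁ e₂ a₂ v o a₂ b h1 h2 hdeg he hoa.symm hob.symm ω hc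
  have iVb01 : ∀ ω : Config E, ω e₁ = false →
      (Function.update ω e₂ true ∈ Vb ↔ Function.update ω e₂ false ∈ Vb) :=
    fun ω hc => conn_update_e₂_iff ends e₁ e₂ a₂ v o v b h1 h2 hdeg he hov.symm hob.symm ω hc
  have iO01 : ∀ ω : Config E, ω e₁ = false →
      (Function.update ω e₂ true ∈ O ↔ Function.update ω e₂ false ∈ F) := by
    intro ω hc
    have hov' : Conn ends (Function.update ω e₂ true) o v :=
      conn_of_openAdj ⟨e₂, by simp, by rw [h2, Sym2.eq_swap]⟩
    have hFω := iF01 ω hc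
    constructor
    · intro h; exact hFω.1 (conn_trans h hov')
    · intro h; exact conn_trans (hFω.2 h) (conn_symm hov')
  have iB11 : ∀ ω : Config E, ω e₂ = true →
      (Function.update ω e₁ true ∈ B ↔ Function.update ω e₁ false ∈ B ∪ Vb) :=
    fun ω ho => conn_update_e₁_open_iff ends e₁ e₂ a₂ v o b h1 h2 hdeg he hob hoa hov ω ho
  -- subsets
  have hsubO : openEdge e₁ ⊆ O := openEdge_e₁_subset_connEvent ends e₁ a₂ o h1
  have hsubF : openEdge e₁ ∩ openEdge e₂ ⊆ F := openEdge_inter_subset_connEvent ends e₁ e₂ a₂ v o h1 h2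
  have hsubO' : openEdge e₁ ∩ openEdge e₂ ⊆ O := fun ω hω => hsubO hω.1
  have hsubOF : openEdge e₁ ∩ openEdge e₂ ⊆ O ∩ F := fun ω hω => ⟨hsubO' hω, hsubF hω⟩
  have hsubW : openEdge e₂ ⊆ W := fun ω hω => conn_of_openAdj ⟨e₂, hω, h2⟩
  -- world (1,0)
  have hcomm10 : P10 = Function.update (Function.update p e₂ (0 : R)) e₁ (1 : R) :=
    Function.update_comm he (1 : R) (0 : R) p
  have hF10 : prob P10 F = prob P00 F := prob_pin10_eq_pin00 p e₁ e₂ he iF10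
  have hB10 : prob P10 B = prob P00 B := prob_pin10_eq_pin00 p e₁ e₂ he iB10
  have hBF10 : prob P10 (B ∩ F) = prob P00 (B ∩ F) :=
    prob_pin10_eq_pin00 p e₁ e₂ he fun ω hc => and_congr (iB10 ω hc) (iF10 ω hc)
  have hO10 : prob P10 O = 1 := by
    rw [hcomm10]
    exact prob_update_one_eq_one_of_subset _ (hp.update e₂ le_rfl zero_le_one) e₁ O hsubO
  have hOB10 : prob P10 (O ∩ B) = prob P00 B := by
    rw [Set.inter_comm, hcomm10, prob_update_one_inter_eq_of_subset _ e₁ B O hsubO, ← hcomm10, hB10]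
  have hOF10 : prob P10 (O ∩ F) = prob P00 F := by
    rw [Set.inter_comm, hcomm10, prob_update_one_inter_eq_of_subset _ e₁ F O hsubO, ← hcomm10, hF10]
  have hR10 : prob P10 (Fᶜ ∩ W) = 0 := by
    have := prob_pin10_eq_pin00 p e₁ e₂ he (A := Fᶜ ∩ W) (A' := Fᶜ ∩ F)
      fun ω hc => and_congr (not_congr (iF10 ω hc)) (iW10 ω hc)
    rwa [Set.compl_inter_self, prob_empty] at this
  -- world (0,1)
  have hF01 : prob P01 F = prob P00 F := prob_pin01_eq_pin00 p e₁ e₂ he iF01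
  have hB01 : prob P01 B = prob P00 B := prob_pin01_eq_pin00 p e₁ e₂ he iB01
  have hBF01 : prob P01 (B ∩ F) = prob P00 (B ∩ F) :=
    prob_pin01_eq_pin00 p e₁ e₂ he fun ω hc => and_congr (iB01 ω hc) (iF01 ω hc)
  have hO01 : prob P01 O = prob P00 F := prob_pin01_eq_pin00 p e₁ e₂ he iO01
  have hOB01 : prob P01 (O ∩ B) = prob P00 (B ∩ F) := by
    have := prob_pin01_eq_pin00 p e₁ e₂ he (A := O ∩ B) (A' := F ∩ B)
      fun ω hc => and_congr (iO01 ω hc) (iB01 ω hc)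
    rwa [Set.inter_comm F B] at this
  have hOF01 : prob P01 (O ∩ F) = prob P00 F := by
    have := prob_pin01_eq_pin00 p e₁ e₂ he (A := O ∩ F) (A' := F ∩ F)
      fun ω hc => and_congr (iO01 ω hc) (iF01 ω hc)
    rwa [Set.inter_self] at this
  have hR01 : prob P01 (Fᶜ ∩ W) = 1 - prob P00 F := by
    rw [prob_update_one_inter_eq_of_subset _ e₂ Fᶜ W hsubW, prob_compl, hF01]
  -- world (1,1)
  have hF11 : prob P11 F = 1 := pin11_eq_one_of_subset p hp e₁ e₂ he F hsubF
  have hO11 : prob P11 O = 1 := pin11_eq_one_of_subset p hp e₁ e₂ he O hsubO'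
  have hOF11 : prob P11 (O ∩ F) = 1 := pin11_eq_one_of_subset p hp e₁ e₂ he (O ∩ F) hsubOF
  have hB11 : prob P11 B = prob P00 (B ∪ Vb) := by
    rw [prob_pin11_eq_pin01 p e₁ e₂ he iB11]
    exact prob_pin01_eq_pin00 p e₁ e₂ he fun ω hc => or_congr (iB01 ω hc) (iVb01 ω hc)
  have hOB11 : prob P11 (O ∩ B) = prob P00 (B ∪ Vb) := by
    rw [Set.inter_comm, pin11_inter_eq_of_subset p e₁ e₂ he B O hsubO', hB11]
  have hBF11 : prob P11 (B ∩ F) = prob P00 (B ∪ Vb) := by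
    rw [pin11_inter_eq_of_subset p e₁ e₂ he B F hsubF, hB11]
  have hR11 : prob P11 (Fᶜ ∩ W) = 0 := by
    refine le_antisymm ?_ (prob_nonneg hp11 _)
    calc prob P11 (Fᶜ ∩ W) ≤ prob P11 Fᶜ := prob_inter_le_left hp11 _ _
      _ = 0 := by rw [prob_compl, hF11, sub_self]
  -- world (0,0): `o` is isolated
  have hO00 : prob P00 O = 0 := pin00_B p ends e₁ e₂ a₂ o hdeg he hoa
  have hW00 : prob P00 W = 0 := pin00_B p ends e₁ e₂ v o hdeg he hov
  have hOB00 : prob P00 (O ∩ B) = 0 :=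
    le_antisymm (by rw [← hO00]; exact prob_inter_le_left hp00 _ _) (prob_nonneg hp00 _)
  have hOF00 : prob P00 (O ∩ F) = 0 :=
    le_antisymm (by rw [← hO00]; exact prob_inter_le_left hp00 _ _) (prob_nonneg hp00 _)
  have hR00 : prob P00 (Fᶜ ∩ W) = 0 :=
    le_antisymm (by rw [← hW00]; exact prob_inter_le_right hp00 _ _) (prob_nonneg hp00 _)
  -- totals
  have tF := prob_eq_pin2 p e₁ e₂ he F
  have tO := prob_eq_pin2 p e₁ e₂ he O
  have tB := prob_eq_pin2 p e₁ e₂ he B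
  have tOB := prob_eq_pin2 p e₁ e₂ he (O ∩ B)
  have tOF := prob_eq_pin2 p e₁ e₂ he (O ∩ F)
  have tBF := prob_eq_pin2 p e₁ e₂ he (B ∩ F)
  have tR := prob_eq_pin2 p e₁ e₂ he (Fᶜ ∩ W)
  rw [← hP11, ← hP10, ← hP01, ← hP00] at tF tO tB tOB tOF tBF tR
  rw [hF11, hF10, hF01] at tF
  rw [hO11, hO10, hO01, hO00] at tO
  rw [hB11, hB10, hB01] at tB
  rw [hOB11, hOB10, hOB01, hOB00] at tOB
  rw [hOF11, hOF10, hOF01, hOF00] at tOF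
  rw [hBF11, hBF10, hBF01] at tBF
  rw [hR11, hR10, hR01, hR00] at tR
  unfold zpp
  rw [prob_compl, tF, tO, tB, tOB, tOF, tBF, tR]
  ring

include hp in
/-- **`(Z″)` holds on the `o`-family.** -/
theorem zpp_two_edge_o_nonneg (h1 : ends e₁ = s(a₂, o)) (h2 : ends e₂ = s(v, o))
    (hdeg : ∀ e, o ∈ ends e → e = e₁ ∨ e = e₂) (he : e₁ ≠ e₂) (hob : o ≠ b) (hoa : o ≠ a₂)
    (hov : o ≠ v) : 0 ≤ zpp p ends v a₂ o b := by
  rw [zpp_two_edge_o_eq p hp ends e₁ e₂ a₂ v o b h1 h2 hdeg he hob hoa hov]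
  set P00 := Function.update (Function.update p e₁ (0 : R)) e₂ (0 : R) with hP00
  have hp00 : IsProbVec P00 := (hp.update e₁ le_rfl zero_le_one).update e₂ le_rfl zero_le_one
  have hα0 := hp.nonneg e₁
  have hα1 := hp.le_one e₁
  have hε0 := hp.nonneg e₂
  have hε1 := hp.le_one e₂
  have hs1 := prob_le_one hp00 (connEvent ends a₂ v)
  -- the bracket: `P₀(B ∩ Fᶜ) ≤ P₀((B ∪ Vb) ∩ Fᶜ) ≤ P₀(B ∪ Vb) · P₀(Fᶜ)`
  have hsplit := prob_inter_add_prob_inter_compl P00 (connEvent ends a₂ b) (connEvent ends a₂ v)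
  have hmono : prob P00 (connEvent ends a₂ b ∩ (connEvent ends a₂ v)ᶜ) ≤
      prob P00 ((connEvent ends a₂ v)ᶜ ∩ (connEvent ends a₂ b ∪ connEvent ends v b)) :=
    prob_mono hp00 fun ω ⟨hb, hf⟩ => ⟨hf, Or.inl hb⟩
  have hH := prob_inter_le_prob_mul_prob_of_isLowerSet hp00
    (isUpperSet_connEvent ends a₂ v).compl
    ((isUpperSet_connEvent ends a₂ b).union (isUpperSet_connEvent ends v b))
  rw [prob_compl] at hH
  have hlast : 0 ≤ prob P00 (connEvent ends a₂ b ∪ connEvent ends v b) *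
      (1 - prob P00 (connEvent ends a₂ v)) -
      (prob P00 (connEvent ends a₂ b) - prob P00 (connEvent ends a₂ b ∩ connEvent ends a₂ v)) := by
    nlinarith [hsplit, hmono, hH]
  have hαε : p e₁ * p e₂ ≤ 1 := by nlinarith
  exact mul_nonneg (mul_nonneg (mul_nonneg (mul_nonneg (mul_nonneg (mul_nonneg hα0 hε0)
    (sub_nonneg.2 hα1)) (sub_nonneg.2 hε1)) (sub_nonneg.2 hαε)) (sub_nonneg.2 hs1)) hlast

end TwoEdgeO

end RowC1

end Summit.Ventures.PercRepro2
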